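import Literature.NumberTheory.LFunctions.Zhang2022.KnifeEdgeLenZDegreeShortPolyDense
import HarnessLib

/-!
# Negative lane of `PsiGradedTablesClosePoly` (h2′): the diagonal main-term form of the LINEAR sub-unit poly piece —
# `𝔅(θ − x) = 8θ/π + (52/3)πθ³` exactly; `41.98 < 𝔅 < 42.00` at `θ = 9/10` (the S4 display design)

Y. Zhang, *Discrete mean estimates and the Landau–Siegel zero*, arXiv:2211.02515v1 [Zhang2022LandauSiegel] — an
unrefereed manuscript under adjudication; nothing here asserts any of its claims and nothing here is a statement about
Landau–Siegel zeros. Desk lemma of the §G referee (ls-ref-1; F1-THRESHOLD v1.1 §2, the number `41.989` re-derived by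
ls-theory), (A)-free calculus on `MainTermFormPSD.mainTermForm_eq`:

* `polyPiece_linear`, `polyPieceDeriv_linear` — the poly piece of `p = θ − X` is `x ↦ max(θ − x, 0)` with marked
  derivative `−1_{x<θ}` (as real casts);
* `integral_linear_sq`, `integral_linear`, `integral_indicator_lt_one` — `∫₀¹ max(θ−x,0)² = θ³/3`, `∫₀¹ max(θ−x,0) = θ²/2`,
  `∫₀¹ 1_{x<θ} = θ` for `0 ≤ θ ≤ 1`;
* **`mainTermForm_linearPiece`** — for `0 < θ ≤ 1`: `𝔅(polyPiece θ (θ − X)) = 8θ/π + (52/3)πθ³`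
  (terms: `(8/π)·θ`, `Im`-terms `0` (real data), `88π·θ³/3`, `−24π·(θ²/2)·θ`);
* `mainTermForm_linearPiece_nine_tenths` — **`41.98 < 𝔅 < 42`** at `θ = 9/10` (`= 36/(5π) + 3159π/250`, with
  `3.1415 < π < 3.1416`), the diagonal at the θ = 0.9 equal long sub-unit poly design of the S4 wrap display; and
  `polyShortPiece_linear` — it is a `PolyShortPiece θ` (a leg of `SubUnitPolyPairs` for `θ < 1`).

No Theses statement asserted; no new `Prop`, no `def`; axioms standard.
-/

noncomputable section

open Complex Real ComplexConjugate Set MeasureTheory intervalIntegral Polynomial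

namespace Summit.Parity.GeneralizedHardyLittlewood.Theorems.PsiGradedTablesClosePoly.Negative

open Literature.NumberTheory.LFunctions.Zhang2022 Literature.NumberTheory.LFunctions.Zhang2022.KnifeEdge

/-! ### Part 1 — the linear piece pointwise -/

/-- The poly piece of `θ − X` is `x ↦ max(θ − x, 0)` (real). [cite: Zhang2022LandauSiegel, §7 (7.2) p.13] -/
theorem polyPiece_linear (θ : ℝ) :
    polyPiece θ (C (θ : ℂ) - X) = fun x => ((max (θ - x) 0 : ℝ) : ℂ) := by
  funext x
  by_cases hx : x < θ
  · rw [polyPiece_of_lt hx, max_eq_left (sub_nonneg.mpr hx.le)]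
    simp
  · rw [polyPiece_of_le (not_lt.mp hx), max_eq_right (sub_nonpos.mpr (not_lt.mp hx))]
    simp

/-- Its marked derivative is `−1` below `θ` and `0` from `θ` on. [cite: Zhang2022LandauSiegel, §7 (7.2) p.13] -/
theorem polyPieceDeriv_linear (θ : ℝ) :
    polyPieceDeriv θ (C (θ : ℂ) - X) = fun x => ((if x < θ then (-1 : ℝ) else 0 : ℝ) : ℂ) := by
  funext x
  by_cases hx : x < θ
  · rw [polyPieceDeriv_of_lt hx, if_pos hx]
    simp
  · rw [polyPieceDeriv_of_le (not_lt.mp hx), if_neg hx]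
    simp

/-- The linear piece is a polynomial short piece of length `θ ≤ 1`. [cite: Zhang2022LandauSiegel, §7 (7.2) p.13] -/
theorem polyShortPiece_linear {θ : ℝ} (hθ1 : θ ≤ 1) :
    PolyShortPiece θ (polyPiece θ (C (θ : ℂ) - X)) (polyPieceDeriv θ (C (θ : ℂ) - X)) :=
  ⟨hθ1, C (θ : ℂ) - X, by simp, rfl, rfl⟩

/-! ### Part 2 — the three real integrals -/

/-- `∫₀¹ max(θ − x, 0)² dx = θ³/3` for `0 ≤ θ ≤ 1`. [folklore] -/
theorem integral_linear_sq {θ : ℝ} (hθ : 0 ≤ θ) (hθ1 : θ ≤ 1) :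
    ∫ x in (0:ℝ)..1, (max (θ - x) 0) ^ 2 = θ ^ 3 / 3 := by
  have hc : Continuous fun x : ℝ => (max (θ - x) 0) ^ 2 := by fun_prop
  rw [← integral_add_adjacent_intervals (hc.intervalIntegrable 0 θ) (hc.intervalIntegrable θ 1)]
  have h1 : ∫ x in (0:ℝ)..θ, (max (θ - x) 0) ^ 2 = ∫ x in (0:ℝ)..θ, (θ - x) ^ 2 := by
    refine integral_congr fun x hx => ?_
    rw [uIcc_of_le hθ] at hx
    simp [max_eq_left (sub_nonneg.mpr hx.2)]
  have h2 : ∫ x in θ..1, (max (θ - x) 0) ^ 2 = ∫ x in θ..1, (0:ℝ) := by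
    refine integral_congr fun x hx => ?_
    rw [uIcc_of_le hθ1] at hx
    simp [max_eq_right (sub_nonpos.mpr hx.1)]
  rw [h1, h2, intervalIntegral.integral_zero, add_zero]
  have h3 : ∫ x in (0:ℝ)..θ, (θ - x) ^ 2 = ∫ x in (0:ℝ)..θ, x ^ 2 := by
    have := intervalIntegral.integral_comp_sub_left (fun x : ℝ => x ^ 2) θ (a := 0) (b := θ)
    simpa using this
  rw [h3, integral_pow]
  ring

/-- `∫₀¹ max(θ − x, 0) dx = θ²/2` for `0 ≤ θ ≤ 1`. [folklore] -/
theorem integral_linear {θ : ℝ} (hθ : 0 ≤ θ) (hθ1 : θ ≤ 1) :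
    ∫ x in (0:ℝ)..1, max (θ - x) 0 = θ ^ 2 / 2 := by
  have hc : Continuous fun x : ℝ => max (θ - x) 0 := by fun_prop
  rw [← integral_add_adjacent_intervals (hc.intervalIntegrable 0 θ) (hc.intervalIntegrable θ 1)]
  have h1 : ∫ x in (0:ℝ)..θ, max (θ - x) 0 = ∫ x in (0:ℝ)..θ, (θ - x) := by
    refine integral_congr fun x hx => ?_
    rw [uIcc_of_le hθ] at hx
    simp [max_eq_left (sub_nonneg.mpr hx.2)]
  have h2 : ∫ x in θ..1, max (θ - x) 0 = ∫ x in θ..1, (0:ℝ) := by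
    refine integral_congr fun x hx => ?_
    rw [uIcc_of_le hθ1] at hx
    simp [max_eq_right (sub_nonpos.mpr hx.1)]
  rw [h1, h2, intervalIntegral.integral_zero, add_zero, integral_sub intervalIntegrable_const intervalIntegral.intervalIntegrable_id,
    intervalIntegral.integral_const, integral_id]
  simp; ring

/-- `∫₀¹ 1_{x<θ} dx = θ` for `0 ≤ θ ≤ 1`. [folklore] -/
theorem integral_indicator_lt_one {θ : ℝ} (hθ : 0 ≤ θ) (hθ1 : θ ≤ 1) :
    ∫ x in (0:ℝ)..1, (if x < θ then (1:ℝ) else 0) = θ := by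
  -- a.e. equal to the indicator of `{x | x ≤ θ}` (they differ at the single point `θ`)
  have hae : ∀ᵐ x ∂(volume : Measure ℝ), x ∈ Set.uIoc (0:ℝ) 1 →
      (if x < θ then (1:ℝ) else 0) = indicator {x | x ≤ θ} (fun _ => (1:ℝ)) x := by
    have hne : ∀ᵐ x ∂(volume : Measure ℝ), x ≠ θ := by simp [ae_iff]
    filter_upwards [hne] with x hx _
    rcases lt_or_gt_of_ne hx with h | h
    · rw [if_pos h, indicator_of_mem (show x ∈ {x | x ≤ θ} from h.le)]
    · rw [if_neg (not_lt.mpr h.le), indicator_of_notMem (show x ∉ {x | x ≤ θ} from not_le.mpr h)]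
  rw [integral_congr_ae hae, integral_indicator ⟨hθ, hθ1⟩, intervalIntegral.integral_const]
  simp

/-! ### Part 3 — `𝔅(θ − x) = 8θ/π + (52/3)πθ³` -/

/-- **`𝔅` of the linear sub-unit poly piece, exactly:** for `0 < θ ≤ 1`,
`𝔅(polyPiece θ (θ − X)) = 8θ/π + (52/3)πθ³` (`(8/π)∫p′² + 88π∫p² − 24π(∫p)·p(0)`; the `Im`-terms of
`mainTermForm_eq` vanish on real data). [cite: Zhang2022LandauSiegel, §7 Prop 7.1 (7.2) p.44; §2 (2.32)] -/
theorem mainTermForm_linearPiece {θ : ℝ} (hθ : 0 < θ) (hθ1 : θ ≤ 1) :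
    mainTermForm (polyPiece θ (C (θ : ℂ) - X)) (polyPieceDeriv θ (C (θ : ℂ) - X)) = 8 * θ / π + 52 / 3 * π * θ ^ 3 := by
  rw [polyPiece_linear, polyPieceDeriv_linear, mainTermForm_eq]
  -- (1) ∫ ‖g′‖² = θ
  have h1 : ∫ x in (0:ℝ)..1, ‖(((if x < θ then (-1:ℝ) else 0 : ℝ)) : ℂ)‖ ^ 2 = θ := by
    have e : ∫ x in (0:ℝ)..1, ‖(((if x < θ then (-1:ℝ) else 0 : ℝ)) : ℂ)‖ ^ 2 = ∫ x in (0:ℝ)..1, (if x < θ then (1:ℝ) else 0) := by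
      refine integral_congr fun x _ => ?_
      split_ifs <;> simp
    rw [e, integral_indicator_lt_one hθ.le hθ1]
  -- (2) Im ∫ g′ conj g = 0 (real data)
  have h2 : (∫ x in (0:ℝ)..1, (((if x < θ then (-1:ℝ) else 0 : ℝ)) : ℂ) * conj (((max (θ - x) 0 : ℝ)) : ℂ)).im = 0 := by
    have : (fun x : ℝ => (((if x < θ then (-1:ℝ) else 0 : ℝ)) : ℂ) * conj (((max (θ - x) 0 : ℝ)) : ℂ))
        = fun x : ℝ => (((if x < θ then (-1:ℝ) else 0) * max (θ - x) 0 : ℝ) : ℂ) := by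
      funext x; rw [Complex.conj_ofReal]; push_cast; ring
    rw [this, intervalIntegral.integral_ofReal, Complex.ofReal_im]
  -- (3) ∫ ‖g‖² = θ³/3
  have h3 : ∫ x in (0:ℝ)..1, ‖(((max (θ - x) 0 : ℝ)) : ℂ)‖ ^ 2 = θ ^ 3 / 3 := by
    have e : ∫ x in (0:ℝ)..1, ‖(((max (θ - x) 0 : ℝ)) : ℂ)‖ ^ 2 = ∫ x in (0:ℝ)..1, (max (θ - x) 0) ^ 2 := by
      refine integral_congr fun x _ => ?_
      rw [Complex.norm_real, Real.norm_eq_abs, sq_abs]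
    rw [e, integral_linear_sq hθ.le hθ1]
  -- (4) Im ∫ g conj(∫₀ˣ g) = 0 (real data)
  have h4 : (∫ x in (0:ℝ)..1, (((max (θ - x) 0 : ℝ)) : ℂ) * conj (∫ t in (0:ℝ)..x, (((max (θ - t) 0 : ℝ)) : ℂ))).im = 0 := by
    have : (fun x : ℝ => (((max (θ - x) 0 : ℝ)) : ℂ) * conj (∫ t in (0:ℝ)..x, (((max (θ - t) 0 : ℝ)) : ℂ)))
        = fun x : ℝ => (((max (θ - x) 0) * (∫ t in (0:ℝ)..x, max (θ - t) 0) : ℝ) : ℂ) := by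
      funext x; rw [intervalIntegral.integral_ofReal, Complex.conj_ofReal]; push_cast; ring
    rw [this, intervalIntegral.integral_ofReal, Complex.ofReal_im]
  -- (5) Re(conj(∫g)(g 0 + g 1)) = (θ²/2)·θ
  have h5 : (conj (∫ t in (0:ℝ)..1, (((max (θ - t) 0 : ℝ)) : ℂ)) * ((((max (θ - 0) 0 : ℝ)) : ℂ) + (((max (θ - 1) 0 : ℝ)) : ℂ))).re
      = θ ^ 2 / 2 * θ := by
    rw [intervalIntegral.integral_ofReal, integral_linear hθ.le hθ1, Complex.conj_ofReal, sub_zero,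
      max_eq_left hθ.le, max_eq_right (by linarith : θ - 1 ≤ 0)]
    push_cast
    simp [← Complex.ofReal_pow]
  -- (6) Im(g 0 conj g 1) = 0
  have h6 : ((((max (θ - 0) 0 : ℝ)) : ℂ) * conj (((max (θ - 1) 0 : ℝ)) : ℂ)).im = 0 := by
    rw [Complex.conj_ofReal, ← Complex.ofReal_mul, Complex.ofReal_im]
  rw [h1, h2, h3, h4, h5, h6]
  ring

/-- **The number at the S4 display design** `θ = 9/10` (F1-THRESHOLD v1.1 §2: `𝔅(0.9 − x) = 36/(5π) + 3159π/250 = 41.989`):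
`41.98 < 𝔅 < 42`. [cite: Zhang2022LandauSiegel, §7 Prop 7.1 (7.2) p.44] -/
theorem mainTermForm_linearPiece_nine_tenths :
    (41.98 : ℝ) < mainTermForm (polyPiece (9/10) (C ((9/10 : ℝ) : ℂ) - X)) (polyPieceDeriv (9/10) (C ((9/10 : ℝ) : ℂ) - X))
      ∧ mainTermForm (polyPiece (9/10) (C ((9/10 : ℝ) : ℂ) - X)) (polyPieceDeriv (9/10) (C ((9/10 : ℝ) : ℂ) - X)) < 42 := by
  rw [mainTermForm_linearPiece (by norm_num) (by norm_num)]
  have hπ1 : (3.1415 : ℝ) < π := by linarith [Real.pi_gt_d4]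
  have hπ2 : π < (3.1416 : ℝ) := by linarith [Real.pi_lt_d4]
  have hπ0 : (0:ℝ) < π := Real.pi_pos
  constructor
  · -- 8·0.9/π + (52/3)π·0.729 > 7.2/3.1416 + 12.636·3.1415
    have hdiv : 7.2 / 3.1416 < 8 * (9/10 : ℝ) / π := by
      rw [div_lt_div_iff₀ (by norm_num) hπ0]; nlinarith
    nlinarith
  · have hdiv : 8 * (9/10 : ℝ) / π < 7.2 / 3.1415 := by
      rw [div_lt_div_iff₀ hπ0 (by norm_num)]; nlinarith
    nlinarith

end Summit.Parity.GeneralizedHardyLittlewood.Theorems.PsiGradedTablesClosePoly.Negative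

end
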